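import Literature.NumberTheory.Automorphic.UnitaryGroupBorelSiegelSetStructure
import Literature.NumberTheory.Automorphic.UnitaryGroupBorelModulusTwo
import HarnessLib

/-!
# On a Siegel set `S = Ω · S_T · (B ∩ K_U)` of `B(𝔸_F) ≤ U(J₂)` the unipotent part and the root value stay in compacta
# (structure clause of the Borel Siegel set, H-side sibling of brick H9b (i) at `N = 2`)

Topic `NumberTheory/Automorphic`; namespace `Literature.NumberTheory.Automorphic.UnitaryGroup`.  THEOREMS ONLY (no definition, no
named fact, no instance, no notation, no `sorry`).  ★ `UnitaryGroupBorelSiegelSetStructure` is typed at general `N` in its §§1–2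
(`continuous_diagUnit`, `diagUnit_mul_of_torusPart_eq`, `torusPart_mul_mul_eq`, `borelHeight_mul_mul_eq`) and `N = 3` in the root values and
the clause; at `N = 2` there is ONE root value `d₀⁻¹ d₁` and the torus contracts the LINE `N(𝔸_F) ≅ 𝔸_E⁻` through it (★ H-B1b
`coe_middleCoord_torusConj_two`: `(t⁻¹ u t)₀₁ = (d₀⁻¹ d₁) · u₀₁`).  H-side copy of LAWS 1–5 of the T1 engine
`Cruxes/H413/Lines/F0_T1InnerFormTraceIdentity.lean` (cell `pub/hodgecm-mathlib`, crux H413; census `CENSUS-LAWS-Hside.F0P3a-p03g6.md` §3 LAW 1;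
B-p14 (g26) NEXT-3 (R2)).  HC_CM is proved only modulo the printed citations until rung 0 closes.

* §1 `continuous_rootValue_two`, `rootValue_two_mul` — the single root value `b ↦ d₀⁻¹ d₁` on `B(𝔸_F) ≤ U(J₂)`.
* §2 **`exists_isCompact_torusConj_mem_two`** — TORUS CONTRACTION ON THE LINE: for compact `W ⊆ N(𝔸_F)` and `R ⊆ 𝔸_E` there is a compact
  `W' ⊆ N(𝔸_F)` with `t⁻¹ w t ∈ W'` for every `w ∈ W` and every torus `t` whose root value lies in `R` (the `N = 2` sibling of ★
  `exists_isCompact_torusConj_mem`).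
* §3 **`exists_isCompact_structure_of_mem_siegel_two`** — THE CLAUSE: compact `Ω' ⊆ G(𝔸_F)`, `R' ⊆ 𝔸_E` with `(torusPart b)⁻¹ b ∈ Ω'` and
  `d₀⁻¹ d₁ ∈ R'` for every `b ∈ Ω · S_T · (B ∩ K_U)` with `1 ≤ H(b)`, given the root window `R` of `S_T` above height `1` (★ H-B4
  `exists_torusSiegelSet_two` LETTER clause).

## References
* J. D. Rogawski, *Automorphic Representations of Unitary Groups in Three Variables* (1990), §2.2 (p. 13) [Rogawski1990].
* J. Arthur, *A trace formula for reductive groups I*, Duke Math. J. 45 (1978), §5 [Arthur1978TraceFormulaI].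
-/

set_option autoImplicit false

noncomputable section

open NumberField IsDedekindDomain Topology Set
open scoped NNReal MatrixGroups Pointwise

namespace Literature.NumberTheory.Automorphic

namespace UnitaryGroup

variable {F E : Type} [Field F] [NumberField F] [Field E] [NumberField E] [Algebra F E] {c : E ≃ₐ[F] E}

/-! ## §1 The single root value of `U(J₂)` on `B(𝔸_F)` -/

/-- The root value `b ↦ d₀⁻¹ d₁` (`d = diagUnit b`) is continuous on `B(𝔸_F) ≤ U(J₂)` (★ `continuous_diagUnit`).
[cite: Rogawski1990, §1.10] -/
theorem continuous_rootValue_two : Continuous fun b : borelAdelic F E c 2 =>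
    (((diagUnit b.2 0)⁻¹ * diagUnit b.2 1 : (AdeleRing (𝓞 E) E)ˣ) : AdeleRing (𝓞 E) E) :=
  Units.continuous_val.comp
    (((continuous_apply 0).comp continuous_diagUnit).inv.mul ((continuous_apply 1).comp continuous_diagUnit))

/-- Root value `d₀⁻¹ d₁` of a product of torus elements of `U(J₂)` (★ `diagUnit_mul_of_torusPart_eq`). [cite: Rogawski1990, §1.10] -/
theorem rootValue_two_mul {t t' : borelAdelic F E c 2} (ht : torusPart t = t) (ht' : torusPart t' = t') :
    (((diagUnit (t * t').2 0)⁻¹ * diagUnit (t * t').2 1 : (AdeleRing (𝓞 E) E)ˣ) : AdeleRing (𝓞 E) E) =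
      (((diagUnit t.2 0)⁻¹ * diagUnit t.2 1 : (AdeleRing (𝓞 E) E)ˣ) : AdeleRing (𝓞 E) E) *
        (((diagUnit t'.2 0)⁻¹ * diagUnit t'.2 1 : (AdeleRing (𝓞 E) E)ˣ) : AdeleRing (𝓞 E) E) := by
  rw [← Units.val_mul, diagUnit_mul_of_torusPart_eq ht ht' 0, diagUnit_mul_of_torusPart_eq ht ht' 1]
  congr 1
  rw [mul_inv]
  simp only [mul_assoc, mul_left_comm]

/-! ## §2 Torus contraction on the line -/

omit [NumberField F] in
/-- `𝔸_E⁻` is closed in `𝔸_E` (fixed points of the continuous `x ↦ -c(x)`). [folklore] -/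
private theorem isClosed_traceZeroAdele₂ : IsClosed ((traceZeroAdele F E c : Set (AdeleRing (𝓞 E) E))) := by
  haveI : T2Space (FiniteAdeleRing (𝓞 E) E) := inferInstanceAs <| T2Space
    (RestrictedProduct (fun w : HeightOneSpectrum (𝓞 E) => w.adicCompletion E)
      (fun w => (w.adicCompletionIntegers E : Set (w.adicCompletion E))) Filter.cofinite)
  haveI : T2Space (InfiniteAdeleRing E) :=
    inferInstanceAs <| T2Space ((w : InfinitePlace E) → w.Completion)
  haveI : T2Space (AdeleRing (𝓞 E) E) := inferInstanceAs <| T2Space (InfiniteAdeleRing E × FiniteAdeleRing (𝓞 E) E)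
  have h : (traceZeroAdele F E c : Set (AdeleRing (𝓞 E) E)) = {x | conjAdele F E c x = -x} := rfl
  rw [h]
  exact isClosed_eq (continuous_conjAdele F E c) continuous_neg

/-- **TORUS CONTRACTION ON THE LINE.** For compact `W ⊆ N(𝔸_F)` and `R ⊆ 𝔸_E` there is a compact `W' ⊆ N(𝔸_F)`
(`= n(R · (W)₀₁ ∩ 𝔸_E⁻)`) with `t⁻¹ w t ∈ W'` for every `w ∈ W` and every `t ∈ T(𝔸_F)` whose root value `d₀⁻¹ d₁` lies in `R`
(★ `coe_middleCoord_torusConj_two`: `(t⁻¹ w t)₀₁ = (d₀⁻¹ d₁) · w₀₁`; Rogawski §2.2: on a Siegel set `a⁻¹ ω a` stays in a compact set).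
[cite: Rogawski1990, §2.2 (p. 13)] -/
theorem exists_isCompact_torusConj_mem_two {W : Set (adelicUnipotent F E c 2)} (hW : IsCompact W)
    {R : Set (AdeleRing (𝓞 E) E)} (hR : IsCompact R) :
    ∃ W' : Set (adelicUnipotent F E c 2), IsCompact W' ∧
      ∀ (t : (quasiSplit F E c 2).Adelic) (ht : t ∈ torusAdelic F E c 2)
        (d : Fin 2 → (AdeleRing (𝓞 E) E)ˣ), glDiagonal 2 (AdeleRing (𝓞 E) E) d = adelicVal F E c 2 _ t →
        (((d 0)⁻¹ * d 1 : (AdeleRing (𝓞 E) E)ˣ) : AdeleRing (𝓞 E) E) ∈ R →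
        ∀ w ∈ W, (⟨t⁻¹ * (w : (quasiSplit F E c 2).Adelic) * t,
          conj_mem_adelicUnipotent (torusAdelic_le_borelAdelic ht) w.2⟩ : adelicUnipotent F E c 2) ∈ W' := by
  have hij : (((0 : Fin 2) : Fin 2) : ℕ) + 1 = (((1 : Fin 2) : Fin 2) : ℕ) := rfl
  have hN : 2 = 2 * (((0 : Fin 2) : Fin 2) : ℕ) + 2 := rfl
  -- the compact coordinate range `(W)₀₁ ⊆ 𝔸_E` and the box `R · (W)₀₁ ∩ 𝔸_E⁻`
  have hY : IsCompact ((Subtype.val : traceZeroAdele F E c → AdeleRing (𝓞 E) E) '' (middleCoord hij hN '' W)) :=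
    (hW.image (continuous_middleCoord_two hij hN)).image continuous_subtype_val
  set K₀ : Set (AdeleRing (𝓞 E) E) :=
    (fun p : AdeleRing (𝓞 E) E × AdeleRing (𝓞 E) E => p.1 * p.2) ''
      (R ×ˢ ((Subtype.val : traceZeroAdele F E c → AdeleRing (𝓞 E) E) '' (middleCoord hij hN '' W))) with hK₀
  have hK₀c : IsCompact K₀ := (hR.prod hY).image (continuous_fst.mul continuous_snd)
  set K : Set (traceZeroAdele F E c) := (Subtype.val : traceZeroAdele F E c → AdeleRing (𝓞 E) E) ⁻¹' K₀ with hK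
  have hKc : IsCompact K :=
    (isClosed_traceZeroAdele₂ (F := F) (E := E) (c := c)).isClosedEmbedding_subtypeVal.isCompact_preimage hK₀c
  refine ⟨(fun b : traceZeroAdele F E c => middleRootUnipotent hij hN (Multiplicative.ofAdd b)) '' K,
    hKc.image (continuous_middleRootUnipotent_two hij hN), fun t ht d hd hR₁ w hw => ?_⟩
  -- `t` as an element of `T(𝔸_F) ≤ B(𝔸_F)`
  set tB : torusInBorel F E c 2 := ⟨⟨t, torusAdelic_le_borelAdelic ht⟩, ht⟩ with htB
  have hd' : glDiagonal 2 (AdeleRing (𝓞 E) E) d =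
      adelicVal F E c 2 _ ((tB : borelAdelic F E c 2) : (quasiSplit F E c 2).Adelic) := hd
  set u : adelicUnipotent F E c 2 := ⟨t⁻¹ * (w : (quasiSplit F E c 2).Adelic) * t,
    conj_mem_adelicUnipotent (torusAdelic_le_borelAdelic ht) w.2⟩ with hu
  have hu' : u = ⟨((tB : borelAdelic F E c 2) : (quasiSplit F E c 2).Adelic)⁻¹ * (w : (quasiSplit F E c 2).Adelic) *
      ((tB : borelAdelic F E c 2) : (quasiSplit F E c 2).Adelic), conj_mem_adelicUnipotent (tB : borelAdelic F E c 2).2 w.2⟩ := rfl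
  rw [eq_middleRootUnipotent_two hij hN u]
  refine Set.mem_image_of_mem _ ?_
  show ((middleCoord hij hN u : traceZeroAdele F E c) : AdeleRing (𝓞 E) E) ∈ K₀
  rw [hu', coe_middleCoord_torusConj_two hij hN tB hd' w]
  exact ⟨(_, _), Set.mk_mem_prod hR₁ ⟨middleCoord hij hN w, Set.mem_image_of_mem _ hw, rfl⟩, rfl⟩

/-! ## §3 The structure clause on `S = Ω · S_T · (B ∩ K_U)` at `N = 2` -/

/-- `N(𝔸_F)` is closed in `G(𝔸_F)` (plumbing, any `N`). [folklore] -/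
private theorem isClosed_adelicUnipotent₂ {N : ℕ} :
    IsClosed ((adelicUnipotent F E c N : Set (quasiSplit F E c N).Adelic)) := by
  haveI : T2Space (FiniteAdeleRing (𝓞 E) E) := inferInstanceAs <| T2Space
    (RestrictedProduct (fun w : HeightOneSpectrum (𝓞 E) => w.adicCompletion E)
      (fun w => (w.adicCompletionIntegers E : Set (w.adicCompletion E))) Filter.cofinite)
  haveI : T2Space (InfiniteAdeleRing E) :=
    inferInstanceAs <| T2Space ((w : InfinitePlace E) → w.Completion)
  haveI : T2Space (AdeleRing (𝓞 E) E) := inferInstanceAs <| T2Space (InfiniteAdeleRing E × FiniteAdeleRing (𝓞 E) E)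
  change IsClosed (⇑(adelicVal F E c N ((StdForm.antidiagonal N).over E)) ⁻¹'
    ((upperUnitriangular (Fin N) (AdeleRing (𝓞 E) E) : Subgroup (GL (Fin N) (AdeleRing (𝓞 E) E))) :
      Set (GL (Fin N) (AdeleRing (𝓞 E) E))))
  exact (isClosed_upperUnitriangular (R := AdeleRing (𝓞 E) E)).preimage continuous_subtype_val

/-- **THE STRUCTURE CLAUSE OF THE BOREL SIEGEL SET OF `U(J₂)`.** Let `Ω ⊆ B(𝔸_F)` be compact and contained in `N(𝔸_F)`, `S_T ⊆ B(𝔸_F)`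
consist of torus elements whose root value `d₀⁻¹ d₁` lies in a compact `R ⊆ 𝔸_E` above height `1` (★ H-B4 LETTER), and
`B ∩ K_U = {k : adelicVal k ∈ K_∞ · GL₂(𝒪̂_E)}`. Then there are compact `Ω' ⊆ G(𝔸_F)` and `R' ⊆ 𝔸_E` such that every
`b ∈ Ω · S_T · (B ∩ K_U)` with `1 ≤ H(b)` has unipotent part `(torusPart b)⁻¹ b ∈ Ω'` and root value in `R'`: with `b = n t k`, `k = t_k n_k`,
`torusPart b = t t_k`, the root values multiply (§1), `H(b) = H(t)`, and `(torusPart b)⁻¹ b = (t t_k)⁻¹ n (t t_k) · n_k` with the first factor in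
the compact of §2. [cite: Rogawski1990, §2.2 (p. 13)] [cite: Arthur1978TraceFormulaI, §5] -/
theorem exists_isCompact_structure_of_mem_siegel_two
    {Ω ST : Set (borelAdelic F E c 2)} (hΩc : IsCompact Ω)
    (hΩN : Ω ⊆ (unipotentInBorel F E c 2 : Set (borelAdelic F E c 2)))
    (hSTt : ∀ t ∈ ST, torusPart t = t)
    {R : Set (AdeleRing (𝓞 E) E)} (hR : IsCompact R)
    (hST : ∀ t ∈ ST, 1 ≤ borelHeight ((t : borelAdelic F E c 2) : (quasiSplit F E c 2).Adelic) →
      (((diagUnit t.2 0)⁻¹ * diagUnit t.2 1 : (AdeleRing (𝓞 E) E)ˣ) : AdeleRing (𝓞 E) E) ∈ R) :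
    ∃ Ω' : Set (quasiSplit F E c 2).Adelic, IsCompact Ω' ∧
      ∃ R' : Set (AdeleRing (𝓞 E) E), IsCompact R' ∧
        ∀ b ∈ Ω * ST * {k : borelAdelic F E c 2 |
            adelicVal F E c 2 ((StdForm.antidiagonal 2).over E) (k : (quasiSplit F E c 2).Adelic) ∈
              standardMaximalCompactGL 2 E},
          1 ≤ borelHeight ((b : borelAdelic F E c 2) : (quasiSplit F E c 2).Adelic) →
          (((torusPart b)⁻¹ * b : borelAdelic F E c 2) : (quasiSplit F E c 2).Adelic) ∈ Ω' ∧
          (((diagUnit b.2 0)⁻¹ * diagUnit b.2 1 : (AdeleRing (𝓞 E) E)ˣ) : AdeleRing (𝓞 E) E) ∈ R' := by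
  -- `B ∩ K_U` is compact in `B(𝔸_F)`
  set KB : Set (borelAdelic F E c 2) := {k : borelAdelic F E c 2 |
    adelicVal F E c 2 ((StdForm.antidiagonal 2).over E) (k : (quasiSplit F E c 2).Adelic) ∈
      standardMaximalCompactGL 2 E} with hKB
  have hKBc : IsCompact KB := by
    have h := isClosed_borelAdelic.isClosedEmbedding_subtypeVal.isCompact_preimage
      (isCompact_comap_adelicVal_standardMaximalCompactGL (F := F) (E := E) (c := c) (N := 2))
    exact h
  -- the root value of `torusPart k`, `k ∈ B ∩ K_U`, ranges in a compact `U`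
  have hKT : IsCompact (torusPart '' KB) := hKBc.image continuous_torusPart
  set U : Set (AdeleRing (𝓞 E) E) := (fun s : borelAdelic F E c 2 =>
    (((diagUnit s.2 0)⁻¹ * diagUnit s.2 1 : (AdeleRing (𝓞 E) E)ˣ) : AdeleRing (𝓞 E) E)) '' (torusPart '' KB) with hU
  have hUc : IsCompact U := hKT.image continuous_rootValue_two
  -- the enlarged root window `R' = R · U`
  set R' : Set (AdeleRing (𝓞 E) E) :=
    (fun p : AdeleRing (𝓞 E) E × AdeleRing (𝓞 E) E => p.1 * p.2) '' (R ×ˢ U) with hR'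
  have hR'c : IsCompact R' := (hR.prod hUc).image (continuous_fst.mul continuous_snd)
  -- `Ω` as a compact subset `W` of `N(𝔸_F) = adelicUnipotent`
  set W : Set (adelicUnipotent F E c 2) := (fun m : adelicUnipotent F E c 2 => (m : (quasiSplit F E c 2).Adelic)) ⁻¹'
    ((Subtype.val : borelAdelic F E c 2 → (quasiSplit F E c 2).Adelic) '' Ω) with hW
  have hWc : IsCompact W :=
    (isClosed_adelicUnipotent₂ (F := F) (E := E) (c := c) (N := 2)).isClosedEmbedding_subtypeVal.isCompact_preimage
      (hΩc.image continuous_subtype_val)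
  -- torus contraction on the line (§2) with the enlarged window
  obtain ⟨W', hW'c, hW'⟩ := exists_isCompact_torusConj_mem_two (F := F) (E := E) (c := c) hWc hR'c
  -- the unipotent parts `(torusPart k)⁻¹ k`, `k ∈ B ∩ K_U`, range in a compact `NK ⊆ G(𝔸_F)`
  set NK : Set (quasiSplit F E c 2).Adelic := (fun k : borelAdelic F E c 2 =>
    (((torusPart k)⁻¹ * k : borelAdelic F E c 2) : (quasiSplit F E c 2).Adelic)) '' KB with hNK
  have hNKc : IsCompact NK :=
    hKBc.image ((continuous_torusPart.inv.mul continuous_id).subtype_val)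
  -- `Ω' = W' · NK`
  set Ω' : Set (quasiSplit F E c 2).Adelic :=
    (fun p : (quasiSplit F E c 2).Adelic × (quasiSplit F E c 2).Adelic => p.1 * p.2) ''
      (((fun m : adelicUnipotent F E c 2 => (m : (quasiSplit F E c 2).Adelic)) '' W') ×ˢ NK) with hΩ'
  have hΩ'c : IsCompact Ω' := ((hW'c.image continuous_subtype_val).prod hNKc).image
    (continuous_fst.mul continuous_snd)
  refine ⟨Ω', hΩ'c, R', hR'c, ?_⟩
  -- unpack `b = n t k`
  rintro b ⟨x, ⟨n, hn, t, ht, rfl⟩, k, hk, rfl⟩ hH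
  have hnN : ((n : borelAdelic F E c 2) : (quasiSplit F E c 2).Adelic) ∈ adelicUnipotent F E c 2 := hΩN hn
  have htt : torusPart t = t := hSTt t ht
  have hkK : adelicVal F E c 2 ((StdForm.antidiagonal 2).over E) (k : (quasiSplit F E c 2).Adelic) ∈
      standardMaximalCompactGL 2 E := hk
  -- `H(b) = H(t) ≥ 1`
  have hHt : 1 ≤ borelHeight ((t : borelAdelic F E c 2) : (quasiSplit F E c 2).Adelic) := by
    rw [← borelHeight_mul_mul_eq hnN hkK]
    exact hH
  -- torus part `t t_k`
  set tk : borelAdelic F E c 2 := torusPart k with htk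
  have htkt : torusPart tk = tk :=
    torusPart_eq_self_of_mem (torusPart_mem_torusAdelic k)
  have hTP : torusPart (n * t * k) = t * tk := torusPart_mul_mul_eq hnN htt
  have hTPt : torusPart (t * tk) = t * tk := by rw [torusPart_mul, htt, htkt]
  -- `t · tk ∈ T(𝔸_F)` with diagonal `d = diagUnit (t tk)`
  have hTmem : (((t * tk : borelAdelic F E c 2)) : (quasiSplit F E c 2).Adelic) ∈ torusAdelic F E c 2 := by
    have h := torusPart_mem_torusAdelic (t * tk)
    rwa [hTPt] at h
  have hd : glDiagonal 2 (AdeleRing (𝓞 E) E) (diagUnit (t * tk).2) =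
      adelicVal F E c 2 _ (((t * tk : borelAdelic F E c 2)) : (quasiSplit F E c 2).Adelic) :=
    (adelicVal_eq_glDiagonal_of_torusPart_eq hTPt).symm
  -- the root value of `b` is that of `t · tk`, which lies in `R'`
  have hroot : ∀ i, diagUnit (n * t * k).2 i = diagUnit (t * tk).2 i := fun i => by
    rw [← diagUnit_torusPart (n * t * k) i]
    exact congrArg (fun s : borelAdelic F E c 2 => diagUnit s.2 i) hTP
  have htkU : tk ∈ torusPart '' KB := ⟨k, hk, htk.symm⟩
  have hRmem : (((diagUnit (t * tk).2 0)⁻¹ * diagUnit (t * tk).2 1 : (AdeleRing (𝓞 E) E)ˣ) : AdeleRing (𝓞 E) E) ∈ R' := by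
    rw [rootValue_two_mul htt htkt]
    exact ⟨(_, _), Set.mk_mem_prod (hST t ht hHt) (Set.mem_image_of_mem _ htkU), rfl⟩
  refine ⟨?_, ?_⟩
  · -- unipotent part `(t tk)⁻¹ (n t k) = Ad((t tk)⁻¹)(n) · (tk⁻¹ k) ∈ W' · NK`
    set n' : adelicUnipotent F E c 2 := ⟨((n : borelAdelic F E c 2) : (quasiSplit F E c 2).Adelic), hnN⟩ with hn'
    have hn'W : n' ∈ W := ⟨n, hn, rfl⟩
    have hconj := hW' _ hTmem (diagUnit (t * tk).2) hd hRmem n' hn'W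
    rw [hTP]
    refine ⟨(_, _), Set.mk_mem_prod (Set.mem_image_of_mem _ hconj) ⟨k, hk, rfl⟩, ?_⟩
    change ((((t * tk : borelAdelic F E c 2)) : (quasiSplit F E c 2).Adelic))⁻¹ *
        ((n : borelAdelic F E c 2) : (quasiSplit F E c 2).Adelic) *
        (((t * tk : borelAdelic F E c 2)) : (quasiSplit F E c 2).Adelic) *
        ((((torusPart k)⁻¹ * k : borelAdelic F E c 2)) : (quasiSplit F E c 2).Adelic) =
      ((((t * tk)⁻¹ * (n * t * k) : borelAdelic F E c 2)) : (quasiSplit F E c 2).Adelic)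
    rw [← htk]
    simp only [Subgroup.coe_mul, Subgroup.coe_inv]
    group
  · rw [hroot 0, hroot 1]
    exact hRmem

end UnitaryGroup

end Literature.NumberTheory.Automorphic

end
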